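import Mathlib
import Literature.NumberTheory.Sieve.ParityBarrier
import Summits.Parity.GeneralizedHardyLittlewood.Theorems.LiouvilleMADCosetDecorrelationStubNormalForm

/-!
# The bridge: mean-corrected coset residual (K1) + one-point bound ⇒ mean-free coset input

Stub `stub_meanFree_of_meanCorrected` of line `SketchIdeator3` of crux stmt-Parity-13317
(`Summit.Parity.GeneralizedHardyLittlewood.Theses.LiouvilleMAD.CosetDecorrelation`,
card `farey-level-mean-coupling`, IdeatorMemo3 §F3); sources: Mathlib (`Nat.Ioc_filter_modEq_card`,
`Real.rpow_le_rpow_of_exponent_le`) + the landed StubNormalForm (`normalForm_coset_eq_classInner`,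
`normalForm_sum_classSum`, `stub_normalForm`); `|λ| ≤ 1` is
`Literature.NumberTheory.Sieve.abs_liouville_le_one`.

Write `u(m) = λ(mn+c)`, `v(m) = λ(mn'+c)` on the block `I = (M,2M]` (`M` elements), `S = Σ_I u`,
`S' = Σ_I v`, classes `I_a = {m ∈ I : m ≡ a (mod j)}` (`a < j`) of sizes `c_a`, class sums
`A(a) = Σ_{I_a} u`, `B(a) = Σ_{I_a} v`.  By the normal form, the mean-corrected coset sum of K1 is
`X = T − S S'/j = Σ_{a<j} A₁(a) B₁(a)` with `A₁ = A − S/j`, `B₁ = B − S'/j` (`stub_normalForm`), and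
the mean-free coset sum consumed by the engine is `Y = Σ_{a<j} A₂(a) B₂(a)` with
`A₂(a) = Σ_{I_a} (u − S/M) = A(a) − (S/M) c_a`, `B₂(a) = B(a) − (S'/M) c_a`
(`normalForm_coset_eq_classInner`).  The classes of `M` consecutive integers have sizes
`|c_a − M/j| ≤ 1` (`bridge_classCard_sub_le`), so the differences
`δ_a = A₂(a) − A₁(a) = (S/M)(M/j − c_a)` and `δ'_a = B₂(a) − B₁(a) = (S'/M)(M/j − c_a)` are at most
`|S|/M, |S'|/M ≤ 1` in size; with `Y − X = Σ_a [A₂ δ'_a + δ_a B₁]`, `Σ_a |A₂(a)| ≤ 2M` and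
`Σ_a |B₁(a)| ≤ 2M` this gives `|Y| ≤ |X| + 2|S'| + 2|S|` (`bridge_meanFree_le`).  With K1
(`|X| ≤ C₁ M^{3/4+ϑ₁}`) and the one-point bound (`|S|, |S'| ≤ C₃ M^{1−κ₃} = C₃ M^{3/4+(1/4−κ₃)}`)
this is `≤ (C₁⁺ + 4 C₃⁺) M^{3/4+ϑ}` for `ϑ := max ϑ₁ (1/4 − κ₃) < 1/4` (`M ≥ 1` from `1 ≤ n ≤ 2M`).
-/

namespace Summit.Parity.GeneralizedHardyLittlewood.Theorems.CosetDecorrelation.FareyLevelMeanCoupling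

open Finset

/-- **Class sizes of a block of `M` consecutive integers**: for `j ≥ 1` and any residue `a`,
`|#{m ∈ (M,2M] : m ≡ a (mod j)} − M/j| ≤ 1` (Mathlib's `Nat.Ioc_filter_modEq_card`: the count is
`⌊(2M − a)/j⌋ − ⌊(M − a)/j⌋`). [folklore] -/
theorem bridge_classCard_sub_le (M j a : ℕ) (hj : 0 < j) :
    |(((Finset.Ioc M (2 * M)).filter (fun m => m ≡ a [MOD j])).card : ℝ) - (M : ℝ) / j| ≤ 1 := by
  have hq : |((((Finset.Ioc M (2 * M)).filter (fun m => m ≡ a [MOD j])).card : ℤ) : ℚ)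
      - (M : ℚ) / j| ≤ 1 := by
    rw [Nat.Ioc_filter_modEq_card M (2 * M) hj a]
    have hMj : (0 : ℚ) ≤ (M : ℚ) / j := by positivity
    have hxy : (((2 * M : ℕ) : ℚ) - a) / j = (((M : ℕ) : ℚ) - a) / j + (M : ℚ) / j := by
      push_cast; ring
    have h1 := Int.floor_le ((((2 * M : ℕ) : ℚ) - a) / j)
    have h2 := Int.lt_floor_add_one ((((2 * M : ℕ) : ℚ) - a) / j)
    have h3 := Int.floor_le ((((M : ℕ) : ℚ) - a) / j)
    have h4 := Int.lt_floor_add_one ((((M : ℕ) : ℚ) - a) / j)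
    have hmono : ⌊(((M : ℕ) : ℚ) - a) / j⌋ ≤ ⌊(((2 * M : ℕ) : ℚ) - a) / j⌋ :=
      Int.floor_le_floor (by linarith)
    rw [max_eq_left (sub_nonneg.mpr hmono), Int.cast_sub, abs_le]
    constructor <;> linarith
  have h := (Rat.cast_le (K := ℝ)).mpr hq
  push_cast at h
  exact h

/-- Summing the absolute class sums over the classes: `Σ_{a<j} |Σ_{I_a} w| ≤ Σ_I |w|` for `j ≥ 1`
(the classes partition the block, `normalForm_sum_classSum`). [folklore] -/
theorem bridge_sum_abs_classSum_le (w : ℕ → ℝ) (M j : ℕ) (hj : 1 ≤ j) :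
    ∑ a ∈ Finset.range j, |∑ m ∈ (Finset.Ioc M (2 * M)).filter (fun m => m ≡ a [MOD j]), w m|
      ≤ ∑ m ∈ Finset.Ioc M (2 * M), |w m| := by
  rw [← normalForm_sum_classSum (fun m => |w m|) M j hj]
  exact sum_le_sum fun a _ => abs_sum_le_sum_abs _ _

/-- Perturbing an inner product: if `|A₂ − A₁| ≤ α` and `|B₂ − B₁| ≤ β` pointwise on `s`, then
`|Σ_s A₂ B₂| ≤ |Σ_s A₁ B₁| + β Σ_s |A₂| + α Σ_s |B₁|`
(`A₂ B₂ − A₁ B₁ = A₂ (B₂ − B₁) + (A₂ − A₁) B₁`). [folklore] -/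
theorem bridge_abs_sum_mul_le (s : Finset ℕ) (A₂ B₂ A₁ B₁ : ℕ → ℝ) (α β : ℝ)
    (hA : ∀ a ∈ s, |A₂ a - A₁ a| ≤ α) (hB : ∀ a ∈ s, |B₂ a - B₁ a| ≤ β) :
    |∑ a ∈ s, A₂ a * B₂ a|
      ≤ |∑ a ∈ s, A₁ a * B₁ a| + β * ∑ a ∈ s, |A₂ a| + α * ∑ a ∈ s, |B₁ a| := by
  have e : ∑ a ∈ s, A₂ a * B₂ a
      = ∑ a ∈ s, A₁ a * B₁ a + ∑ a ∈ s, (A₂ a * (B₂ a - B₁ a) + (A₂ a - A₁ a) * B₁ a) := by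
    rw [← sum_add_distrib]
    exact sum_congr rfl fun a _ => by ring
  rw [e]
  have key : ∀ a ∈ s, |A₂ a * (B₂ a - B₁ a) + (A₂ a - A₁ a) * B₁ a| ≤ β * |A₂ a| + α * |B₁ a| := by
    intro a ha
    calc |A₂ a * (B₂ a - B₁ a) + (A₂ a - A₁ a) * B₁ a|
        ≤ |A₂ a * (B₂ a - B₁ a)| + |(A₂ a - A₁ a) * B₁ a| := abs_add_le _ _
      _ = |A₂ a| * |B₂ a - B₁ a| + |A₂ a - A₁ a| * |B₁ a| := by rw [abs_mul, abs_mul]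
      _ ≤ |A₂ a| * β + α * |B₁ a| :=
          add_le_add (mul_le_mul_of_nonneg_left (hB a ha) (abs_nonneg _))
            (mul_le_mul_of_nonneg_right (hA a ha) (abs_nonneg _))
      _ = β * |A₂ a| + α * |B₁ a| := by ring
  have h2 := (abs_sum_le_sum_abs _ _).trans (sum_le_sum key)
  have h3 : ∑ a ∈ s, (β * |A₂ a| + α * |B₁ a|) = β * ∑ a ∈ s, |A₂ a| + α * ∑ a ∈ s, |B₁ a| := by
    rw [sum_add_distrib, mul_sum, mul_sum]
  rw [h3] at h2
  calc |∑ a ∈ s, A₁ a * B₁ a + ∑ a ∈ s, (A₂ a * (B₂ a - B₁ a) + (A₂ a - A₁ a) * B₁ a)|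
      ≤ |∑ a ∈ s, A₁ a * B₁ a| + |∑ a ∈ s, (A₂ a * (B₂ a - B₁ a) + (A₂ a - A₁ a) * B₁ a)| :=
        abs_add_le _ _
    _ ≤ |∑ a ∈ s, A₁ a * B₁ a| + (β * ∑ a ∈ s, |A₂ a| + α * ∑ a ∈ s, |B₁ a|) :=
        add_le_add_right h2 _
    _ = _ := (add_assoc _ _ _).symm

/-- **The bridge for general bounded weights** (`M ≥ 1`, `j ≥ 1`, `|u|, |v| ≤ 1`, `S = Σ u`,
`S' = Σ v` over `(M,2M]`): the mean-free coset sum `Y = Σ_{m ≡ m' (j)} (u(m) − S/M)(v(m') − S'/M)`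
and the mean-corrected coset sum `X = Σ_{m ≡ m' (j)} u(m) v(m') − S S'/j` satisfy
`|Y| ≤ |X| + 2|S'| + 2|S|`.  Proof: both are class inner products (`normalForm_coset_eq_classInner`,
`stub_normalForm`), the profiles differ by `(S/M)(M/j − c_a)`, `(S'/M)(M/j − c_a)` with
`|c_a − M/j| ≤ 1` (`bridge_classCard_sub_le`), and `Σ_a |A₂(a)|, Σ_a |B₁(a)| ≤ 2M`. [folklore] -/
theorem bridge_meanFree_le (u v : ℕ → ℝ) {M j : ℕ} (hM : 0 < M) (hj : 1 ≤ j)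
    (hu : ∀ m, |u m| ≤ 1) (hv : ∀ m, |v m| ≤ 1) :
    |∑ p ∈ (Finset.Ioc M (2 * M) ×ˢ Finset.Ioc M (2 * M)).filter
        (fun p : ℕ × ℕ => p.1 ≡ p.2 [MOD j]),
      (u p.1 - (∑ m ∈ Finset.Ioc M (2 * M), u m) / (M : ℝ)) *
        (v p.2 - (∑ m ∈ Finset.Ioc M (2 * M), v m) / (M : ℝ))|
      ≤ |(∑ p ∈ (Finset.Ioc M (2 * M) ×ˢ Finset.Ioc M (2 * M)).filter
            (fun p : ℕ × ℕ => p.1 ≡ p.2 [MOD j]), u p.1 * v p.2)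
          - (∑ m ∈ Finset.Ioc M (2 * M), u m) * (∑ m ∈ Finset.Ioc M (2 * M), v m) / (j : ℝ)|
        + 2 * |∑ m ∈ Finset.Ioc M (2 * M), v m| + 2 * |∑ m ∈ Finset.Ioc M (2 * M), u m| := by
  have hMr : (0 : ℝ) < M := by exact_mod_cast hM
  have hjr : (0 : ℝ) < j := by exact_mod_cast hj
  have hM0 : (M : ℝ) ≠ 0 := hMr.ne'
  have hj0 : (j : ℝ) ≠ 0 := hjr.ne'
  set I : Finset ℕ := Finset.Ioc M (2 * M) with hI
  set S : ℝ := ∑ m ∈ I, u m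
  set S' : ℝ := ∑ m ∈ I, v m
  set cl : ℕ → Finset ℕ := fun a => I.filter (fun m => m ≡ a [MOD j])
  set A₂ : ℕ → ℝ := fun a => ∑ m ∈ cl a, (u m - S / M) with hA₂
  set B₂ : ℕ → ℝ := fun a => ∑ m ∈ cl a, (v m - S' / M) with hB₂
  set A₁ : ℕ → ℝ := fun a => (∑ m ∈ cl a, u m) - S / j with hA₁
  set B₁ : ℕ → ℝ := fun a => (∑ m ∈ cl a, v m) - S' / j with hB₁
  have hY : (∑ p ∈ (I ×ˢ I).filter (fun p : ℕ × ℕ => p.1 ≡ p.2 [MOD j]),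
      (u p.1 - S / M) * (v p.2 - S' / M)) = ∑ a ∈ range j, A₂ a * B₂ a :=
    normalForm_coset_eq_classInner (fun m => u m - S / M) (fun m => v m - S' / M) M j hj
  have hX : (∑ p ∈ (I ×ˢ I).filter (fun p : ℕ × ℕ => p.1 ≡ p.2 [MOD j]), u p.1 * v p.2)
      - S * S' / j = ∑ a ∈ range j, A₁ a * B₁ a := stub_normalForm u v M j hj
  rw [hY, hX]
  -- sizes
  have hcard : (I.card : ℝ) = M := by rw [hI, Nat.card_Ioc, show 2 * M - M = M by omega]
  have hUabs : ∑ m ∈ I, |u m| ≤ M :=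
    (sum_le_sum fun m _ => hu m).trans_eq (by rw [sum_const, nsmul_eq_mul, mul_one, hcard])
  have hVabs : ∑ m ∈ I, |v m| ≤ M :=
    (sum_le_sum fun m _ => hv m).trans_eq (by rw [sum_const, nsmul_eq_mul, mul_one, hcard])
  have hSabs : |S| ≤ M := (abs_sum_le_sum_abs _ _).trans hUabs
  have hS'abs : |S'| ≤ M := (abs_sum_le_sum_abs _ _).trans hVabs
  have hSM : |S / M| ≤ 1 := by rw [abs_div, abs_of_pos hMr, div_le_one hMr]; exact hSabs
  -- the class sizes and the profile differences
  have hc : ∀ a, |(M : ℝ) / j - ((cl a).card : ℝ)| ≤ 1 := fun a => by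
    rw [abs_sub_comm]; exact bridge_classCard_sub_le M j a hj
  have hdiv : ∀ x : ℝ, x / j = x / M * ((M : ℝ) / j) := fun x => by
    rw [div_mul_div_comm, mul_comm x, mul_div_mul_left _ _ hM0]
  have h1 : ∀ a ∈ range j, |A₂ a - A₁ a| ≤ |S / M| := fun a _ => by
    have e : A₂ a - A₁ a = S / M * ((M : ℝ) / j - (cl a).card) := by
      simp only [hA₂, hA₁, sum_sub_distrib, sum_const, nsmul_eq_mul]
      rw [mul_sub, ← hdiv]; ring
    rw [e, abs_mul]
    exact (mul_le_mul_of_nonneg_left (hc a) (abs_nonneg _)).trans_eq (mul_one _)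
  have h2 : ∀ a ∈ range j, |B₂ a - B₁ a| ≤ |S' / M| := fun a _ => by
    have e : B₂ a - B₁ a = S' / M * ((M : ℝ) / j - (cl a).card) := by
      simp only [hB₂, hB₁, sum_sub_distrib, sum_const, nsmul_eq_mul]
      rw [mul_sub, ← hdiv]; ring
    rw [e, abs_mul]
    exact (mul_le_mul_of_nonneg_left (hc a) (abs_nonneg _)).trans_eq (mul_one _)
  -- `Σ_a |A₂(a)| ≤ 2M`
  have h3 : ∑ a ∈ range j, |A₂ a| ≤ 2 * M := by
    calc ∑ a ∈ range j, |A₂ a| ≤ ∑ m ∈ I, |u m - S / M| :=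
          bridge_sum_abs_classSum_le (fun m => u m - S / M) M j hj
      _ ≤ ∑ m ∈ I, (|u m| + 1) := sum_le_sum fun m _ =>
          (abs_sub _ _).trans (add_le_add_right hSM _)
      _ = ∑ m ∈ I, |u m| + M := by rw [sum_add_distrib, sum_const, nsmul_eq_mul, mul_one, hcard]
      _ ≤ M + M := add_le_add_left hUabs _
      _ = 2 * M := by ring
  -- `Σ_a |B₁(a)| ≤ 2M`
  have h4 : ∑ a ∈ range j, |B₁ a| ≤ 2 * M := by
    calc ∑ a ∈ range j, |B₁ a| ≤ ∑ a ∈ range j, (|∑ m ∈ cl a, v m| + |S' / j|) :=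
          sum_le_sum fun a _ => abs_sub _ _
      _ = ∑ a ∈ range j, |∑ m ∈ cl a, v m| + |S'| := by
          rw [sum_add_distrib, sum_const, card_range, nsmul_eq_mul, abs_div, abs_of_pos hjr,
            mul_div_assoc', mul_div_cancel_left₀ _ hj0]
      _ ≤ M + M := add_le_add ((bridge_sum_abs_classSum_le v M j hj).trans hVabs) hS'abs
      _ = 2 * M := by ring
  have hfin : ∀ x : ℝ, |x / M| * (2 * M) = 2 * |x| := fun x => by
    rw [abs_div, abs_of_pos hMr, show |x| / M * (2 * M) = 2 * (|x| / M * M) by ring,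
      div_mul_cancel₀ _ hM0]
  calc |∑ a ∈ range j, A₂ a * B₂ a|
      ≤ |∑ a ∈ range j, A₁ a * B₁ a| + |S' / M| * ∑ a ∈ range j, |A₂ a|
          + |S / M| * ∑ a ∈ range j, |B₁ a| :=
        bridge_abs_sum_mul_le (range j) A₂ B₂ A₁ B₁ |S / M| |S' / M| h1 h2
    _ ≤ |∑ a ∈ range j, A₁ a * B₁ a| + |S' / M| * (2 * M) + |S / M| * (2 * M) :=
        add_le_add (add_le_add le_rfl (mul_le_mul_of_nonneg_left h3 (abs_nonneg _)))
          (mul_le_mul_of_nonneg_left h4 (abs_nonneg _))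
    _ = |∑ a ∈ range j, A₁ a * B₁ a| + 2 * |S'| + 2 * |S| := by rw [hfin, hfin]

/-- **STUB `stub_meanFree_of_meanCorrected`** (line `SketchIdeator3`, THE BRIDGE): the registered
mean-corrected coset residual K1 (correction `S(n)S(n')/j`, exponent `3/4 + ϑ₁`, `ϑ₁ < 1/4`)
together with the one-point bound `|S(n)| ≤ C₃ M^{1−κ₃}` (`κ₃ > 0`) implies the mean-free coset
input H1 of `stub_meanFreeEngine` (correction by the profiles `λ(mn+c) − S(n)/M`): by
`bridge_meanFree_le`
(`u = λ(·n+c)`, `v = λ(·n'+c)`, `|λ| ≤ 1`) the mean-free coset sum is at most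
`|X| + 2|S(n')| + 2|S(n)| ≤ C₁ M^{3/4+ϑ₁} + 4 C₃ M^{1−κ₃} ≤ (C₁⁺ + 4C₃⁺) M^{3/4+ϑ}` with
`ϑ := max ϑ₁ (1/4 − κ₃) < 1/4` (`Real.rpow_le_rpow_of_exponent_le`, `M ≥ 1` as `1 ≤ n ≤ 2M`). -/
theorem stub_meanFree_of_meanCorrected :
    (∀ c : ℤ, c ≠ 0 → ∃ ϑ : ℝ, ϑ < 1 / 4 ∧ ∃ C : ℝ, ∀ M n n' j : ℕ, 1 ≤ n → 1 ≤ n' → n ≠ n' →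
      n ≤ 2 * M → n' ≤ 2 * M → Nat.sqrt M + 1 ≤ j → j < 2 * (Nat.sqrt M + 1) →
        |(∑ p ∈ (Finset.Ioc M (2 * M) ×ˢ Finset.Ioc M (2 * M)).filter
              (fun p : ℕ × ℕ => p.1 ≡ p.2 [MOD j]),
            (ArithmeticFunction.liouville (Int.toNat ((p.1 : ℤ) * n + c)) : ℝ) *
              (ArithmeticFunction.liouville (Int.toNat ((p.2 : ℤ) * n' + c)) : ℝ))
          - (∑ m ∈ Finset.Ioc M (2 * M), (ArithmeticFunction.liouville (Int.toNat ((m : ℤ) * n + c)) : ℝ)) *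
              (∑ m ∈ Finset.Ioc M (2 * M), (ArithmeticFunction.liouville (Int.toNat ((m : ℤ) * n' + c)) : ℝ)) /
                (j : ℝ)|
          ≤ C * (M : ℝ) ^ (3 / 4 + ϑ)) →
    (∀ c : ℤ, c ≠ 0 → ∃ κ : ℝ, 0 < κ ∧ ∃ C : ℝ, ∀ M n : ℕ, 1 ≤ n → n ≤ 2 * M →
      |∑ m ∈ Finset.Ioc M (2 * M), (ArithmeticFunction.liouville (Int.toNat ((m : ℤ) * n + c)) : ℝ)|
        ≤ C * (M : ℝ) ^ (1 - κ)) →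
    (∀ c : ℤ, c ≠ 0 → ∃ ϑ : ℝ, ϑ < 1 / 4 ∧ ∃ C : ℝ, ∀ M n n' j : ℕ, 1 ≤ n → 1 ≤ n' → n ≠ n' →
      n ≤ 2 * M → n' ≤ 2 * M → Nat.sqrt M + 1 ≤ j → j < 2 * (Nat.sqrt M + 1) →
        |∑ p ∈ (Finset.Ioc M (2 * M) ×ˢ Finset.Ioc M (2 * M)).filter
            (fun p : ℕ × ℕ => p.1 ≡ p.2 [MOD j]),
          ((ArithmeticFunction.liouville (Int.toNat ((p.1 : ℤ) * n + c)) : ℝ)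
            - (∑ m ∈ Finset.Ioc M (2 * M),
                (ArithmeticFunction.liouville (Int.toNat ((m : ℤ) * n + c)) : ℝ)) / (M : ℝ)) *
          ((ArithmeticFunction.liouville (Int.toNat ((p.2 : ℤ) * n' + c)) : ℝ)
            - (∑ m ∈ Finset.Ioc M (2 * M),
                (ArithmeticFunction.liouville (Int.toNat ((m : ℤ) * n' + c)) : ℝ)) / (M : ℝ))|
          ≤ C * (M : ℝ) ^ (3 / 4 + ϑ)) := by
  intro hK hP c hc
  obtain ⟨ϑ₁, hϑ₁, C₁, hC₁⟩ := hK c hc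
  obtain ⟨κ₃, hκ₃, C₃, hC₃⟩ := hP c hc
  refine ⟨max ϑ₁ (1 / 4 - κ₃), max_lt hϑ₁ (by linarith), max C₁ 0 + 4 * max C₃ 0, ?_⟩
  intro M n n' j hn hn' hnn' hnM hn'M hj hj'
  have hMpos : 0 < M := by omega
  have hM1 : (1 : ℝ) ≤ M := by exact_mod_cast hMpos
  have hj1 : 1 ≤ j := by omega
  have key := bridge_meanFree_le
    (fun m => (ArithmeticFunction.liouville (Int.toNat ((m : ℤ) * n + c)) : ℝ))
    (fun m => (ArithmeticFunction.liouville (Int.toNat ((m : ℤ) * n' + c)) : ℝ)) hMpos hj1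
    (fun _ => Literature.NumberTheory.Sieve.abs_liouville_le_one _)
    (fun _ => Literature.NumberTheory.Sieve.abs_liouville_le_one _)
  refine key.trans ?_
  have hXb := hC₁ M n n' j hn hn' hnn' hnM hn'M hj hj'
  have hSb := hC₃ M n hn hnM
  have hS'b := hC₃ M n' hn' hn'M
  -- exponents: `M^{3/4+ϑ₁}, M^{1−κ₃} ≤ M^{3/4+ϑ}` for `M ≥ 1`
  have he₁ : (M : ℝ) ^ (3 / 4 + ϑ₁) ≤ (M : ℝ) ^ (3 / 4 + max ϑ₁ (1 / 4 - κ₃)) :=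
    Real.rpow_le_rpow_of_exponent_le hM1 (by have := le_max_left ϑ₁ (1 / 4 - κ₃); linarith)
  have he₃ : (M : ℝ) ^ (1 - κ₃) ≤ (M : ℝ) ^ (3 / 4 + max ϑ₁ (1 / 4 - κ₃)) :=
    Real.rpow_le_rpow_of_exponent_le hM1 (by have := le_max_right ϑ₁ (1 / 4 - κ₃); linarith)
  have hX₁ : (0 : ℝ) ≤ (M : ℝ) ^ (3 / 4 + ϑ₁) := by positivity
  have hX₃ : (0 : ℝ) ≤ (M : ℝ) ^ (1 - κ₃) := by positivity
  have h1 := mul_le_mul_of_nonneg_right (le_max_left C₁ 0) hX₁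
  have h3 := mul_le_mul_of_nonneg_right (le_max_left C₃ 0) hX₃
  have h1' := mul_le_mul_of_nonneg_left he₁ (le_max_right C₁ 0)
  have h3' := mul_le_mul_of_nonneg_left he₃ (le_max_right C₃ 0)
  linarith

end Summit.Parity.GeneralizedHardyLittlewood.Theorems.CosetDecorrelation.FareyLevelMeanCoupling
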